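import Summits.CriticalPhenomena.CardyFormulaZ2.Theorems.CardyQContinuationIsingJetsConformalStubArcLocalisation
import Summits.CriticalPhenomena.CardyFormulaZ2.Theorems.CardyBoundaryCoulombGasRectilinearSufficesMixed
import Literature.Probability.LatticeModels.FKIsingQuadrilateralCrossing
import Literature.Probability.LatticeModels.DiscreteRectBoundaryLoop
import Literature.Probability.LatticeModels.DiscreteExtremalLengthExternalArcsSelfDual

/-!
# Crux `IsingJetsConformal`, stub `stub_design_upper_gluing`:
# the wired zones of the upper gluing of the `n = 0` sandwich
# (route `CardyQContinuation`, item stmt-CriticalPhenomena-5560)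

In the upper half of the `n = 0` sandwich the discretisation `Ω_δ` of a conformal rectangle `R`
(vertex set `meshDomain R.carrier δ`, graph `discreteDomainGraph R.carrier δ`, wired discrete
arcs `discreteArc R.carrier δ (R.arc 0)`, `discreteArc R.carrier δ (R.arc 2)`) is glued into the
Chelkak–Smirnov discrete quadrilateral whose edge set `E` consists of the sides of the closed
`δ`-faces inside `closure Rp.carrier`, `Rp ⊇ R` an enlarged rectangle whose white arcs `1, 3` lie
off `closure R` (U3), whose closure misses the arcs `0, 2` of `R` (U4), and which differs from `R`
only inside the `s`-neighbourhoods of `R.arc 0`, `R.arc 2`, two neighbourhoods that stay `2s`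
apart (U6). From the lattice worker we are given that black vertices of the arc `j ∈ {0, 2}` are
within `C δ` of `Rp.arc j` (ii) and that a vertex of `E` with a missing lattice edge is black or
within `C δ` of the white arcs (iv).

We produce, for all small `δ`, the two wired zones `Z₀, Z₂` consumed by the comparison stub
`stub_loopSymmetricLimit_upperComparison`:
`Z_j = Zb ∩ {v | infDist (δ v) (R.arc j) < s'}` with `s' = s + (max C 0 + 3) δ` and the base zone
`Zb = {v | (v ∈ Ω_δ ∧ v ∉ verts E) ∨ v black}`. The checks are elementary metric geometry:
black vertices are within `C δ + s < s'` of their arc ((ii) and (U6)); a vertex of `Ω_δ` off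
`verts E` has its own face poking out of `closure Rp`, so its mesh point is in `closure R ∖ Rp`
(hence `s`-close to an arc by (U6)) or within `2δ` of `∂Rp = ⋃ arcs of Rp`, the white arcs being
excluded by (U3), so again `s + 2δ ≤ s'`-close to `R.arc 0 ∪ R.arc 2`; two lattice neighbours, one
`s'`-close to `R.arc 0` and the other to `R.arc 2`, would violate the separation in (U6) as
`s' + δ ≤ 2s`; discrete-arc vertices are within `δ` of their arc (`infDist_le_of_mem_discreteArc`)
and therefore not vertices of `E` (those lie in `closure Rp`, a positive distance away from
`R.arc 0 ∪ R.arc 2` by (U4)); and an `Ω_δ`-edge missing from `E` at a vertex of `E` makes that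
vertex black by (iv), the alternative (being `C δ`-close to the white arcs, which are a positive
distance off `closure R` by (U3)) being absurd for a vertex of `Ω_δ ⊆ R`.

Positive separations come from `exists_pos_forall_lt_dist` (compact versus closed disjoint sets).

References: S. Smirnov, C. R. Acad. Sci. Paris 333 (2001), §2 (the discretisation `Ω_δ`);
D. Chelkak, S. Smirnov, Invent. Math. 189 (2012), §6 (discrete quadrilaterals). No new definitions.
-/

namespace Summit.CriticalPhenomena.CardyFormulaZ2.Theorems.CardyQContinuation

open Set Metric Filter Topology
open Literature.Probability.LatticeModels Literature.Probability.LatticeModels.DiscreteRect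
open Literature.Probability.RandomPlanarGeometry
open Literature.Probability.Percolation

noncomputable section

namespace DesignUpperGluing

/-! ### Lattice and mesh geometry -/

/-- The corners of the face at `s` are within `2|δ|` of the corner `δ s`. [folklore] -/
theorem dist_meshPoint_corner_le (δ : ℝ) (s : Site 2) (j : Fin 4) :
    dist (meshPoint δ (corner s j)) (meshPoint δ s) ≤ 2 * |δ| := by
  have h0 : 0 ≤ |δ| := abs_nonneg δ
  have h1 : dist (meshPoint δ (s + dir 0)) (meshPoint δ s) = |δ| := by
    rw [dist_comm]; exact dist_meshPoint_of_adj (adj_add_dir s 0)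
  have h2 : dist (meshPoint δ (s + dir 0 + dir 1)) (meshPoint δ (s + dir 0)) = |δ| := by
    rw [dist_comm]; exact dist_meshPoint_of_adj (adj_add_dir _ 1)
  have h3 : dist (meshPoint δ (s + dir 1)) (meshPoint δ s) = |δ| := by
    rw [dist_comm]; exact dist_meshPoint_of_adj (adj_add_dir s 1)
  have h4 := dist_triangle (meshPoint δ (s + dir 0 + dir 1)) (meshPoint δ (s + dir 0))
    (meshPoint δ s)
  fin_cases j
  · simp [corner, h0]
  · simp only [corner, Fin.mk_one, Matrix.cons_val_one, Matrix.cons_val_zero]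
    linarith
  · simp only [corner, Fin.reduceFinMk, Matrix.cons_val]
    linarith
  · simp only [corner, Fin.reduceFinMk, Matrix.cons_val]
    linarith

/-- The closed face at `s` lies within `2|δ|` of its corner `δ s`. [folklore] -/
theorem dist_le_of_mem_closedSq {δ : ℝ} {s : Site 2} {p : ℂ} (hp : p ∈ closedSq δ s) :
    dist (meshPoint δ s) p ≤ 2 * |δ| := by
  have hsub : closedSq δ s ⊆ closedBall (meshPoint δ s) (2 * |δ|) :=
    convexHull_min (range_subset_iff.2 fun j ↦ dist_meshPoint_corner_le δ s j)
      (convex_closedBall _ _)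
  have := hsub hp
  rwa [mem_closedBall, dist_comm] at this

/-! ### Metric helpers -/

/-- If `z` is within `a` of a nonempty compact `K` all of whose points are strictly within `b` of
`T`, then `z` is strictly within `a + b` of `T`. [folklore] -/
theorem infDist_lt_add_of_subset {z : ℂ} {K T : Set ℂ} (hK : IsCompact K) (hKne : K.Nonempty)
    {a b : ℝ} (hz : infDist z K ≤ a) (hKT : K ⊆ {w | infDist w T < b}) :
    infDist z T < a + b := by
  obtain ⟨w, hwK, hw⟩ := hK.exists_infDist_eq_dist hKne z
  have h1 : infDist w T < b := hKT hwK
  have h2 := infDist_le_infDist_add_dist (s := T) (x := z) (y := w)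
  linarith

/-- Two points at distance `≤ δ`, one strictly within `s'` of `R.arc 0` and the other strictly
within `s'` of `R.arc 2`, contradict the separation clause of (U6) once `s' + δ ≤ 2s`.
[folklore] -/
theorem false_of_near_both (R : ConformalRectangle) {s s' δ : ℝ}
    (hU6d : ∀ z : ℂ, infDist z (R.arc 0) ≤ 2 * s → infDist z (R.arc 2) ≤ 2 * s → False)
    (hs' : s' + δ ≤ 2 * s) (hδ : 0 ≤ δ) {p q : ℂ} (hp : infDist p (R.arc 0) < s')
    (hq : infDist q (R.arc 2) < s') (hpq : dist p q ≤ δ) : False := by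
  refine hU6d p (by linarith) ?_
  have := infDist_le_infDist_add_dist (s := R.arc 2) (x := p) (y := q)
  linarith

/-- A point of `closure R` cannot be within `C δ` of the white arcs `Rp.arc 1 ∪ Rp.arc 3` when
these are at distance `> ρ₃ > C δ` from `closure R`. [folklore] -/
theorem false_of_infDist_white_le (R Rp : ConformalRectangle) {δ C ρ₃ : ℝ}
    (hρ₃ : ∀ p ∈ Rp.arc 1 ∪ Rp.arc 3, ∀ q ∈ closure R.carrier, ρ₃ < dist p q) (hCδ : C * δ < ρ₃)
    {z : ℂ} (hz : z ∈ closure R.carrier) (h : infDist z (Rp.arc 1 ∪ Rp.arc 3) ≤ C * δ) :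
    False := by
  obtain ⟨p, hp, hpd⟩ := ((Rp.isCompact_arc 1).union (Rp.isCompact_arc 3)).exists_infDist_eq_dist
    ⟨_, Or.inl (Rp.pt_mem_arc_self 1)⟩ z
  have := hρ₃ p hp z hz
  rw [dist_comm] at this
  linarith

/-! ### Consequences of clause (i): `E` = the sides of the faces inside `A = closure Rp` -/

section ClauseI

variable {E : Finset (Sym2 (Site 2))} {δ : ℝ} {A : Set ℂ}
  (hE : ∀ e, e ∈ E ↔ ∃ s : Site 2, closedSq δ s ⊆ A ∧
    ∃ j : Fin 4, e = s(corner s j, corner s j + dir j))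
include hE

/-- Under clause (i), every vertex of `E` has its mesh point in `A`. [folklore] -/
theorem meshPoint_mem_of_mem_verts {x : Site 2} (hx : x ∈ verts E) : meshPoint δ x ∈ A := by
  rw [verts, Finset.mem_biUnion] at hx
  obtain ⟨e, he, hxe⟩ := hx
  obtain ⟨s, hs, j, rfl⟩ := (hE e).1 he
  simp only [endpts, Sym2.lift_mk, Finset.mem_insert, Finset.mem_singleton] at hxe
  rcases hxe with rfl | rfl
  · exact hs (subset_convexHull ℝ _ (mem_range_self j))
  · rw [← corner_add_one]
    exact hs (subset_convexHull ℝ _ (mem_range_self (j + 1)))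

/-- Under clause (i), a lattice point whose own face lies in `A` is a vertex of `E`. [folklore] -/
theorem mem_verts_of_closedSq_subset {x : Site 2} (hx : closedSq δ x ⊆ A) : x ∈ verts E := by
  have he : s(corner x 0, corner x 0 + dir 0) ∈ E := (hE _).2 ⟨x, hx, 0, rfl⟩
  have hx0 : corner x 0 = x := by simp [corner]
  rw [hx0] at he
  exact fst_mem_verts_of_aedge_mem (a := (x, 0)) he

/-- Under clause (i), a lattice point off `verts E` has a point of its own closed face outside
`A`, within `2|δ|` of its mesh point. [folklore] -/
theorem exists_not_mem_of_not_mem_verts {x : Site 2} (hx : x ∉ verts E) :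
    ∃ p, p ∉ A ∧ dist (meshPoint δ x) p ≤ 2 * |δ| := by
  obtain ⟨p, hp, hpA⟩ := not_subset.1 (mt (mem_verts_of_closedSq_subset hE) hx)
  exact ⟨p, hpA, dist_le_of_mem_closedSq hp⟩

/-- Under clause (i), the endpoints of an edge of `E` are lattice neighbours. [folklore] -/
theorem adj_of_mem {x y : Site 2} (h : s(x, y) ∈ E) : (zdGraph 2).Adj x y := by
  obtain ⟨s, -, j, he⟩ := (hE _).1 h
  rcases Sym2.eq_iff.1 he with ⟨rfl, rfl⟩ | ⟨rfl, rfl⟩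
  · exact adj_add_dir _ _
  · exact (adj_add_dir _ _).symm

end ClauseI

/-! ### The two geometric localisation facts -/

/-- A vertex of the discrete arc of `R.arc i`, `i ∈ {0, 2}`, is not a vertex of `E` when `E` is
made of faces inside a set `A` at distance `> ρ₄ ≥ δ` from `R.arc 0 ∪ R.arc 2` (discrete-arc
vertices are within `δ` of their arc). [folklore] -/
theorem not_mem_verts_of_mem_discreteArc (R : ConformalRectangle) {E : Finset (Sym2 (Site 2))}
    {δ ρ₄ : ℝ} {A : Set ℂ}
    (hE : ∀ e, e ∈ E ↔ ∃ s : Site 2, closedSq δ s ⊆ A ∧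
      ∃ j : Fin 4, e = s(corner s j, corner s j + dir j))
    (hρ₄ : ∀ p ∈ A, ∀ q ∈ R.arc 0 ∪ R.arc 2, ρ₄ < dist p q) (hδ : 0 < δ) (hδ₄ : δ ≤ ρ₄)
    {i : Fin 4} (hi : i = 0 ∨ i = 2) {x : Site 2} (hx : x ∈ discreteArc R.carrier δ (R.arc i)) :
    x ∉ verts E := fun hxv ↦ by
  have h1 := infDist_le_of_mem_discreteArc R.isOpen hx
  rw [abs_of_pos hδ] at h1
  obtain ⟨a, ha, hda⟩ :=
    (R.isCompact_arc i).exists_infDist_eq_dist ⟨_, R.pt_mem_arc_self i⟩ (meshPoint δ x)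
  have hai : a ∈ R.arc 0 ∪ R.arc 2 := by
    rcases hi with rfl | rfl
    exacts [Or.inl ha, Or.inr ha]
  have h2 := hρ₄ _ (meshPoint_mem_of_mem_verts hE hxv) a hai
  linarith

/-- A vertex of `Ω_δ` off `verts E` is strictly within `s + 2δ` of `R.arc 0` or of `R.arc 2`:
its own face pokes out of `closure Rp`, so its mesh point lies in `closure R ∖ Rp` (U6) or within
`2δ` of a point of `∂Rp = ⋃ arcs of Rp`, which is on a black arc of `Rp` (U6) since the white arcs
are `> ρ₃ ≥ 2δ` away from `closure R` (U3). [folklore] -/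
theorem near_arcs_of_not_mem_verts (R Rp : ConformalRectangle) {E : Finset (Sym2 (Site 2))}
    {δ s ρ₃ : ℝ}
    (hE : ∀ e, e ∈ E ↔ ∃ s : Site 2, closedSq δ s ⊆ closure Rp.carrier ∧
      ∃ j : Fin 4, e = s(corner s j, corner s j + dir j))
    (hρ₃ : ∀ p ∈ Rp.arc 1 ∪ Rp.arc 3, ∀ q ∈ closure R.carrier, ρ₃ < dist p q)
    (hU6a : closure R.carrier \ Rp.carrier ⊆
      {z | infDist z (R.arc 0) < s} ∪ {z | infDist z (R.arc 2) < s})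
    (hU6b : Rp.arc 0 ⊆ {z | infDist z (R.arc 0) < s})
    (hU6c : Rp.arc 2 ⊆ {z | infDist z (R.arc 2) < s})
    (hδ : 0 < δ) (hδ₃ : 2 * δ ≤ ρ₃) {x : Site 2} (hxM : x ∈ meshDomain R.carrier δ)
    (hxv : x ∉ verts E) :
    infDist (meshPoint δ x) (R.arc 0) < s + 2 * δ ∨
      infDist (meshPoint δ x) (R.arc 2) < s + 2 * δ := by
  have hxR : meshPoint δ x ∈ R.carrier := meshDomain_subset_meshVertices _ _ hxM
  by_cases hxRp : meshPoint δ x ∈ Rp.carrier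
  · obtain ⟨p, hpA, hp⟩ := exists_not_mem_of_not_mem_verts hE hxv
    rw [abs_of_pos hδ] at hp
    have hseg : ¬ segment ℝ (meshPoint δ x) p ⊆ Rp.carrier := fun h ↦
      hpA (subset_closure (h (right_mem_segment ℝ _ _)))
    obtain ⟨q, hq, hqf⟩ := exists_mem_segment_frontier Rp.isOpen hxRp hseg
    have hxq : dist (meshPoint δ x) q ≤ 2 * δ := by
      have := segment_subset_closedBall_left (meshPoint δ x) p hq
      rw [mem_closedBall] at this
      rw [dist_comm]
      exact this.trans hp
    rw [← (Rp.iUnion_arc_holds : ⋃ i, Rp.arc i = frontier Rp.carrier), mem_iUnion] at hqf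
    obtain ⟨i, hqi⟩ := hqf
    have key : ∀ T : Set ℂ, q ∈ {z | infDist z T < s} →
        infDist (meshPoint δ x) T < s + 2 * δ := fun T hqT ↦ by
      have := infDist_le_infDist_add_dist (s := T) (x := meshPoint δ x) (y := q)
      simp only [mem_setOf_eq] at hqT
      linarith
    have far : q ∉ Rp.arc 1 ∪ Rp.arc 3 := fun h ↦ by
      have := hρ₃ q h _ (subset_closure hxR)
      rw [dist_comm] at this
      linarith
    fin_cases i
    · exact Or.inl (key _ (hU6b hqi))
    · exact absurd (Or.inl hqi) far
    · exact Or.inr (key _ (hU6c hqi))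
    · exact absurd (Or.inr hqi) far
  · rcases hU6a ⟨subset_closure hxR, hxRp⟩ with h | h
    · left
      simp only [mem_setOf_eq] at h
      linarith
    · right
      simp only [mem_setOf_eq] at h
      linarith

end DesignUpperGluing

open DesignUpperGluing

/-- **Stub `stub_design_upper_gluing`** of the skeleton of the crux `IsingJetsConformal`
(stmt-CriticalPhenomena-5560): for all small mesh `δ`, the wired zones `Z₀, Z₂` of the upper
gluing exist — disjoint, containing the wired discrete arcs of `Ω_δ` and the black vertex sets of
the glued quadrilateral, with no `Ω_δ`- or `E`-edge between them, quadrilateral vertices in the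
zone black, off-zone vertices non-black quadrilateral vertices, and every `Ω_δ`-edge missing
from `E` based in the zone. See the module docstring for the construction. [folklore] -/
theorem stub_design_upper_gluing : (∀ (R Rp : Literature.Probability.RandomPlanarGeometry.ConformalRectangle), Rp.arc 1 ∪ Rp.arc 3 ⊆ (closure R.carrier)ᶜ → closure Rp.carrier ∩ (R.arc 0 ∪ R.arc 2) = ∅ → (∃ s : ℝ, 0 < s ∧ closure R.carrier \ Rp.carrier ⊆ {z | Metric.infDist z (R.arc 0) < s} ∪ {z | Metric.infDist z (R.arc 2) < s} ∧ Rp.arc 0 ⊆ {z | Metric.infDist z (R.arc 0) < s} ∧ Rp.arc 2 ⊆ {z | Metric.infDist z (R.arc 2) < s} ∧ ∀ z : ℂ, Metric.infDist z (R.arc 0) ≤ 2 * s → Metric.infDist z (R.arc 2) ≤ 2 * s → False) → ∀ C : ℝ, ∀ᶠ δ in nhdsWithin (0 : ℝ) (Set.Ioi 0), ∀ (E : Finset (Sym2 (Literature.Probability.LatticeModels.Site 2))) (d₀ : Literature.Probability.LatticeModels.Site 2 × Fin 4) (n : Fin 4 → ℕ), (∀ e, e ∈ E ↔ ∃ s :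 Literature.Probability.LatticeModels.Site 2, Literature.Probability.LatticeModels.DiscreteRect.closedSq δ s ⊆ closure Rp.carrier ∧ ∃ j : Fin 4, e = s(Literature.Probability.LatticeModels.DiscreteRect.corner s j, Literature.Probability.LatticeModels.DiscreteRect.corner s j + Literature.Probability.LatticeModels.DiscreteRect.dir j)) → (∀ x ∈ Literature.Probability.LatticeModels.DiscreteRect.blackVerts E d₀ n 0, Metric.infDist (Literature.Probability.LatticeModels.meshPoint δ x) (Rp.arc 0) ≤ C * δ) → (∀ x ∈ Literature.Probability.LatticeModels.DiscreteRect.blackVerts E d₀ n 2, Metric.infDist (Literature.Probability.LatticeModels.meshPoint δ x) (Rp.arc 2) ≤ C * δ) → (∀ x ∈ Literature.Probability.LatticeModels.DiscreteRect.verts E, (∃ k : Fin 4, s(x, x + Literature.Probability.LatticeModels.DiscreteRect.dir k) ∉ E) → x ∈ Literature.Probability.LatticeModels.DiscreteRect.blackVerts E d₀ n 0 ∪ Literature.Probability.LatticeModels.DiscreteRect.blackVerts E d₀ n 2 ∨ Metric.infDist (Literature.Probability.LatticeModels.meshPoint δ x) (Rp.arc 1 ∪ Rp.arc 3) ≤ C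 * δ) → ∃ (Z₀ Z₂ : Set (Literature.Probability.LatticeModels.Site 2)), Disjoint Z₀ Z₂ ∧ Literature.Probability.LatticeModels.discreteArc R.carrier δ (R.arc 0) ⊆ Z₀ ∧ Literature.Probability.LatticeModels.discreteArc R.carrier δ (R.arc 2) ⊆ Z₂ ∧ Literature.Probability.LatticeModels.DiscreteRect.blackVerts E d₀ n 0 ⊆ Z₀ ∧ Literature.Probability.LatticeModels.DiscreteRect.blackVerts E d₀ n 2 ⊆ Z₂ ∧ (∀ x ∈ Z₀, ∀ y ∈ Z₂, ¬ (Literature.Probability.LatticeModels.discreteDomainGraph R.carrier δ).Adj x y ∧ s(x, y) ∉ E) ∧ (∀ v ∈ Z₀ ∪ Z₂, v ∈ (Literature.Probability.LatticeModels.DiscreteRect.verts E : Set (Literature.Probability.LatticeModels.Site 2)) → v ∈ Literature.Probability.LatticeModels.DiscreteRect.blackVerts E d₀ n 0 ∪ Literature.Probability.LatticeModels.DiscreteRect.blackVerts E d₀ n 2) ∧ (∀ v, v ∈ Literature.Probability.LatticeModels.meshDomain R.carrier δ ∪ (Literature.Probability.LatticeModels.DiscreteRect.verts E : Set (Literature.Probability.LatticeModels.Site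 2)) → v ∉ Z₀ ∪ Z₂ → v ∈ (Literature.Probability.LatticeModels.DiscreteRect.verts E : Set (Literature.Probability.LatticeModels.Site 2)) ∧ v ∉ Literature.Probability.LatticeModels.DiscreteRect.blackVerts E d₀ n 0 ∪ Literature.Probability.LatticeModels.DiscreteRect.blackVerts E d₀ n 2) ∧ (∀ x y : Literature.Probability.LatticeModels.Site 2, (Literature.Probability.LatticeModels.discreteDomainGraph R.carrier δ).Adj x y → s(x, y) ∉ E → x ∈ Z₀ ∪ Z₂)) := by
  intro R Rp hU3 hU4 hU6 C
  obtain ⟨s, hs, hU6a, hU6b, hU6c, hU6d⟩ := hU6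
  -- the two positive separations coming from (U3) and (U4)
  obtain ⟨ρ₃, hρ₃pos, hρ₃⟩ : ∃ r > 0, ∀ p ∈ Rp.arc 1 ∪ Rp.arc 3, ∀ q ∈ closure R.carrier,
      r < dist p q :=
    exists_pos_forall_lt_dist ((Rp.isCompact_arc 1).union (Rp.isCompact_arc 3))
      isClosed_closure (disjoint_left.2 fun p hp hq ↦ hU3 hp hq)
  obtain ⟨ρ₄, hρ₄pos, hρ₄⟩ : ∃ r > 0, ∀ p ∈ closure Rp.carrier, ∀ q ∈ R.arc 0 ∪ R.arc 2,
      r < dist p q :=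
    exists_pos_forall_lt_dist Rp.isBounded.isCompact_closure
      ((R.isClosed_arc 0).union (R.isClosed_arc 2)) (disjoint_iff_inter_eq_empty.2 hU4)
  -- the scale: `M δ < s / 2`, `M δ < ρ₃`, `δ < ρ₄` with `M = max C 0 + 3`
  set M : ℝ := max C 0 + 3 with hM
  have hC0 : 0 ≤ max C 0 := le_max_right _ _
  have hMpos : 0 < M := by positivity
  filter_upwards [Ioo_mem_nhdsGT (show 0 < s / (2 * M) by positivity),
    Ioo_mem_nhdsGT (show 0 < ρ₃ / M by positivity), Ioo_mem_nhdsGT hρ₄pos] with δ hδ₁ hδ₂ hδ₄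
  obtain ⟨hδ, hδ₁⟩ := hδ₁
  have hδ0 : (0 : ℝ) ≤ δ := hδ.le
  have hMδs : M * δ < s / 2 := by
    have := (lt_div_iff₀ (by positivity : (0 : ℝ) < 2 * M)).1 hδ₁
    linarith
  have hMδ₃ : M * δ < ρ₃ := by
    have := (lt_div_iff₀ hMpos).1 hδ₂.2
    linarith
  have hCδ : C * δ ≤ max C 0 * δ := mul_le_mul_of_nonneg_right (le_max_left _ _) hδ0
  have hC0δ : 0 ≤ max C 0 * δ := mul_nonneg hC0 hδ0
  intro E d₀ n hE hii0 hii2 hiv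
  -- the zones
  set s' : ℝ := s + M * δ with hs'
  have k1 : C * δ + s < s' := by rw [hs', hM]; nlinarith
  have k2 : s' + δ ≤ 2 * s := by rw [hs']; nlinarith
  have k3 : s + 2 * δ ≤ s' := by rw [hs', hM]; nlinarith
  have k4 : δ < s' := by rw [hs', hM]; nlinarith
  set Zb : Set (Site 2) := {v | (v ∈ meshDomain R.carrier δ ∧ v ∉ verts E) ∨
    v ∈ blackVerts E d₀ n 0 ∪ blackVerts E d₀ n 2} with hZb
  set Z₀ : Set (Site 2) := Zb ∩ {v | infDist (meshPoint δ v) (R.arc 0) < s'} with hZ₀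
  set Z₂ : Set (Site 2) := Zb ∩ {v | infDist (meshPoint δ v) (R.arc 2) < s'} with hZ₂
  -- black vertices are `s'`-close to their arc, by (ii) and (U6)
  have hb0 : ∀ x ∈ blackVerts E d₀ n 0, infDist (meshPoint δ x) (R.arc 0) < s' := fun x hx ↦
    (infDist_lt_add_of_subset (Rp.isCompact_arc 0) ⟨_, Rp.pt_mem_arc_self 0⟩ (hii0 x hx)
      hU6b).trans k1
  have hb2 : ∀ x ∈ blackVerts E d₀ n 2, infDist (meshPoint δ x) (R.arc 2) < s' := fun x hx ↦
    (infDist_lt_add_of_subset (Rp.isCompact_arc 2) ⟨_, Rp.pt_mem_arc_self 2⟩ (hii2 x hx)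
      hU6c).trans k1
  -- the base zone is covered by the two zones
  have hZbsub : ∀ v ∈ Zb, v ∈ Z₀ ∪ Z₂ := by
    rintro v (⟨hvM, hvv⟩ | hv | hv)
    · rcases near_arcs_of_not_mem_verts R Rp hE hρ₃ hU6a hU6b hU6c hδ (by linarith) hvM hvv
        with h | h
      · exact Or.inl ⟨Or.inl ⟨hvM, hvv⟩, h.trans_le k3⟩
      · exact Or.inr ⟨Or.inl ⟨hvM, hvv⟩, h.trans_le k3⟩
    · exact Or.inl ⟨Or.inr (Or.inl hv), hb0 v hv⟩
    · exact Or.inr ⟨Or.inr (Or.inr hv), hb2 v hv⟩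
  refine ⟨Z₀, Z₂, ?_, ?_, ?_, fun x hx ↦ ⟨Or.inr (Or.inl hx), hb0 x hx⟩,
    fun x hx ↦ ⟨Or.inr (Or.inr hx), hb2 x hx⟩, ?_, ?_, ?_, ?_⟩
  · -- (a) the zones are disjoint: a common vertex would be `s' ≤ 2s`-close to both arcs
    exact disjoint_left.2 fun v hv0 hv2 ↦
      false_of_near_both R hU6d k2 hδ0 hv0.2 hv2.2 (by rw [dist_self]; exact hδ0)
  · -- (b₀) the discrete arc of `R.arc 0`
    intro x hx
    have h1 := infDist_le_of_mem_discreteArc R.isOpen hx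
    rw [abs_of_pos hδ] at h1
    exact ⟨Or.inl ⟨meshBoundary_subset_meshDomain _ _ hx.1,
      not_mem_verts_of_mem_discreteArc R hE hρ₄ hδ hδ₄.2.le (Or.inl rfl) hx⟩, h1.trans_lt k4⟩
  · -- (b₂) the discrete arc of `R.arc 2`
    intro x hx
    have h1 := infDist_le_of_mem_discreteArc R.isOpen hx
    rw [abs_of_pos hδ] at h1
    exact ⟨Or.inl ⟨meshBoundary_subset_meshDomain _ _ hx.1,
      not_mem_verts_of_mem_discreteArc R hE hρ₄ hδ hδ₄.2.le (Or.inr rfl) hx⟩, h1.trans_lt k4⟩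
  · -- (d) no `Ω_δ`-edge and no `E`-edge between the zones
    rintro x ⟨-, hx0⟩ y ⟨-, hy2⟩
    refine ⟨fun hadj ↦ ?_, fun hxy ↦ ?_⟩
    · have hzd : (zdGraph 2).Adj x y :=
        meshGraph_le_zdGraph _ _ (discreteDomainGraph_le_meshGraph _ _ hadj)
      exact false_of_near_both R hU6d k2 hδ0 hx0 hy2
        (by rw [dist_meshPoint_of_adj hzd, abs_of_pos hδ])
    · exact false_of_near_both R hU6d k2 hδ0 hx0 hy2
        (by rw [dist_meshPoint_of_adj (adj_of_mem hE hxy), abs_of_pos hδ])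
  · -- (e) zone vertices of the quadrilateral are black
    rintro v hv hvv
    have hvb : v ∈ Zb := by
      rcases hv with ⟨h, -⟩ | ⟨h, -⟩
      exacts [h, h]
    rcases hvb with ⟨-, hvv'⟩ | h
    · exact absurd hvv hvv'
    · exact h
  · -- (f) off-zone vertices are non-black vertices of the quadrilateral
    intro v hv hvZ
    by_contra hcon
    refine hvZ (hZbsub v ?_)
    by_cases hvv : v ∈ verts E
    · right
      by_contra hb
      exact hcon ⟨hvv, hb⟩
    · left
      rcases hv with h | h
      · exact ⟨h, hvv⟩
      · exact absurd h hvv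
  · -- (g) an `Ω_δ`-edge missing from `E` is based in the zone
    intro x y hadj hxy
    obtain ⟨hmesh, hxM, -⟩ := discreteDomainGraph_adj_iff.1 hadj
    refine hZbsub x ?_
    by_cases hxv : x ∈ verts E
    · right
      obtain ⟨k, rfl⟩ := exists_eq_add_dir_of_adj (meshGraph_le_zdGraph _ _ hmesh)
      rcases hiv x hxv ⟨k, hxy⟩ with h | h
      · exact h
      · exact (false_of_infDist_white_le R Rp hρ₃ (by linarith)
          (subset_closure (meshDomain_subset_meshVertices _ _ hxM)) h).elim
    · exact Or.inl ⟨hxM, hxv⟩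

end

end Summit.CriticalPhenomena.CardyFormulaZ2.Theorems.CardyQContinuation
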